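import Summits.Ventures.WeilGRH.WeilMeasureLatticeBlocks
import HarnessLib

/-!
# rh-explicit (venture WeilGRH): ONE CERTIFIED GRAM DIAGONAL ENTRY IS A ZERO-FREE-BLOCK CERTIFICATE (weil-3 gen15)

Cell `rh-explicit`, WEIL TRACK (structure seat weil-3, gen15).  The general principle behind `WeilMeasureEmptyLowHeights` /
`WeilMeasureFirstLine`, stated once for EVERY rung `a > 0`, EVERY lattice index `n ∈ ℤ` and EVERY radius `0 < x₀ ≤ π`
(certificate ⇒ theorem shape):

* ★ **`measure_block_eq_zero_of_natValued_of_gramCoeff_lt`** (RH-free): if Yoshida's diagonal Gram entry satisfies the single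
  numerical inequality `G_a(n,n) < 2a·(sin x₀/x₀)²`, then EVERY positive measure representing Weil's form on the tests of `[-a, a]`
  that is ℕ-valued on bounded Borel sets VANISHES on the block `[−πn/a − x₀/a, −πn/a + x₀/a]` — the arithmetic spectra compatible
  with Weil positivity on `(−2a, 2a)` (the prime powers `< e^{2a}` + Γ + pole) have no line there;
* ★ **`im_not_mem_block_of_riemannHypothesis_of_gramCoeff_lt`**: under RH (where `WeilPositivityOn a` holds for every `a` and
  `ν_ζ` represents the form), the same inequality certifies that NO non-trivial zero of `ζ` has its ordinate in the block —
  a kernel-checkable zero-free-region certificate from ONE explicit number (`G_a(n,n)` is a finite expression in the prime powers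
  below `e^{2a}`, `ψ`, `ψ′` and an exponential sum, `Literature…Yoshida1992.gramCoeff`), with no evaluation of `ζ`;
* `measureReal_block_lt_one_of_gramCoeff_lt`: the quantitative form `μ(block) ≤ G_a(n,n)/(2a(sin x₀/x₀)²) < 1` for every Weil measure.

At the proved rung `a₀ = 4023/5000` the certified entries `G(±1..±4) ≤ 0.5784 / 0.3127 / 0.5714 / 1.2176` (`LatticeHeightTrig`,
`LatticeArchDiagonalBounds`, `LatticeHeightFour`) are the instances used by `WeilMeasureEmptyLowHeights` and `WeilMeasureFirstLine`.
No definitions, no named facts, standard axioms; nothing here bears on the truth of RH.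
-/

set_option autoImplicit false

noncomputable section

open Complex Set MeasureTheory
open scoped Real ENNReal

namespace Summit.Ventures.WeilGRH

open Literature.NumberTheory.LFunctions
open Literature.NumberTheory.LFunctions.Yoshida1992 (chi gramCoeff)
open Literature.NumberTheory.LFunctions.WeilBochner (zetaZeroHeightMeasure weilQuadratic_eq_integral_of_riemannHypothesis)
open Literature.NumberTheory.LFunctions.ZetaZeros (riemannZetaNontrivialZeros)
open Summit.RiemannHypothesis.RiemannHypothesis.Theorems.WeilFormatC
open Summit.RiemannHypothesis.RiemannHypothesis.Theorems.WeilBochnerMeasure (measure_Icc_lt_top)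

variable {a : ℝ}

/-- **The quantitative block bound**: `μ[−πn/a − x₀/a, −πn/a + x₀/a] ≤ G_a(n,n) / (2a(sin x₀/x₀)²)` for every Weil measure of
the rung `a` (`0 < x₀ < π`, so that the threshold is positive). -/
theorem measureReal_block_le_gramCoeff_div (ha : 0 < a) {μ : Measure ℝ}
    (hμ : ∀ g : ℝ → ℂ, IsWeilTest g → tsupport g ⊆ Icc (-a) a →
      Integrable (fun t : ℝ ↦ ‖weilMellin g (1 / 2 + t * I)‖ ^ 2) μ ∧
        weilQuadratic g = ((∫ t, ‖weilMellin g (1 / 2 + t * I)‖ ^ 2 ∂μ : ℝ) : ℂ))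
    (n : ℤ) {x₀ : ℝ} (hx₀ : 0 < x₀) (hx₀π : x₀ < π) :
    μ.real (Icc (-(π * n / a) - x₀ / a) (-(π * n / a) + x₀ / a)) ≤
      gramCoeff a n n / (2 * a * (Real.sin x₀ / x₀) ^ 2) := by
  have h := blockMass_le_gramCoeff ha hμ n hx₀ hx₀π.le
  have hm : 0 < 2 * a * (Real.sin x₀ / x₀) ^ 2 := by
    have : 0 < Real.sin x₀ := Real.sin_pos_of_pos_of_lt_pi hx₀ hx₀π
    positivity
  rw [le_div_iff₀ hm]
  linarith

/-- `μ(block) < 1` as soon as `G_a(n,n) < 2a(sin x₀/x₀)²`. -/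
theorem measureReal_block_lt_one_of_gramCoeff_lt (ha : 0 < a) {μ : Measure ℝ}
    (hμ : ∀ g : ℝ → ℂ, IsWeilTest g → tsupport g ⊆ Icc (-a) a →
      Integrable (fun t : ℝ ↦ ‖weilMellin g (1 / 2 + t * I)‖ ^ 2) μ ∧
        weilQuadratic g = ((∫ t, ‖weilMellin g (1 / 2 + t * I)‖ ^ 2 ∂μ : ℝ) : ℂ))
    (n : ℤ) {x₀ : ℝ} (hx₀ : 0 < x₀) (hx₀π : x₀ < π) (hG : gramCoeff a n n < 2 * a * (Real.sin x₀ / x₀) ^ 2) :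
    μ.real (Icc (-(π * n / a) - x₀ / a) (-(π * n / a) + x₀ / a)) < 1 := by
  have h := blockMass_le_gramCoeff ha hμ n hx₀ hx₀π.le
  have hm : 0 < 2 * a * (Real.sin x₀ / x₀) ^ 2 := by
    have : 0 < Real.sin x₀ := Real.sin_pos_of_pos_of_lt_pi hx₀ hx₀π
    positivity
  by_contra hge
  have hge' : 1 ≤ μ.real (Icc (-(π * n / a) - x₀ / a) (-(π * n / a) + x₀ / a)) := not_lt.1 hge
  nlinarith

/-- ★ **A GRAM DIAGONAL ENTRY BELOW `2a·sinc²` EXCLUDES EVERY ARITHMETIC LINE FROM ITS BLOCK** (RH-free).  For `a > 0`, `n ∈ ℤ`,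
`0 < x₀ < π` with `G_a(n,n) < 2a(sin x₀/x₀)²`: every positive `μ` representing Weil's form on `[-a, a]` that is ℕ-valued on bounded
Borel sets has `μ[−πn/a − x₀/a, −πn/a + x₀/a] = 0`. -/
theorem measure_block_eq_zero_of_natValued_of_gramCoeff_lt (ha : 0 < a) {μ : Measure ℝ}
    (hμ : ∀ g : ℝ → ℂ, IsWeilTest g → tsupport g ⊆ Icc (-a) a →
      Integrable (fun t : ℝ ↦ ‖weilMellin g (1 / 2 + t * I)‖ ^ 2) μ ∧
        weilQuadratic g = ((∫ t, ‖weilMellin g (1 / 2 + t * I)‖ ^ 2 ∂μ : ℝ) : ℂ))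
    (hN : ∀ s : Set ℝ, MeasurableSet s → Bornology.IsBounded s → ∃ k : ℕ, μ.real s = k)
    (n : ℤ) {x₀ : ℝ} (hx₀ : 0 < x₀) (hx₀π : x₀ < π) (hG : gramCoeff a n n < 2 * a * (Real.sin x₀ / x₀) ^ 2) :
    μ (Icc (-(π * n / a) - x₀ / a) (-(π * n / a) + x₀ / a)) = 0 :=
  measure_eq_zero_of_natValued_lt_one (measure_Icc_lt_top ha hμ _ _).ne (hN _ measurableSet_Icc (Metric.isBounded_Icc _ _))
    (measureReal_block_lt_one_of_gramCoeff_lt ha hμ n hx₀ hx₀π hG)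

/-- ★ **ONE GRAM ENTRY IS A ZERO-FREE-BLOCK CERTIFICATE FOR `ζ` (under RH).**  If the Riemann hypothesis holds, then for every
`a > 0`, `n ∈ ℤ`, `0 < x₀ < π` with `G_a(n,n) < 2a(sin x₀/x₀)²`, NO non-trivial zero of `ζ` has its ordinate in
`[−πn/a − x₀/a, −πn/a + x₀/a]` (`ν_ζ` represents Weil's form under RH and has mass `≥ 1` at every ordinate of a zero). -/
theorem im_not_mem_block_of_riemannHypothesis_of_gramCoeff_lt (hRH : RiemannHypothesis) (ha : 0 < a) (n : ℤ) {x₀ : ℝ}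
    (hx₀ : 0 < x₀) (hx₀π : x₀ < π) (hG : gramCoeff a n n < 2 * a * (Real.sin x₀ / x₀) ^ 2)
    {ρ : ℂ} (hρ : ρ ∈ riemannZetaNontrivialZeros) :
    ρ.im ∉ Icc (-(π * n / a) - x₀ / a) (-(π * n / a) + x₀ / a) := by
  have hν : ∀ g : ℝ → ℂ, IsWeilTest g → tsupport g ⊆ Icc (-a) a →
      Integrable (fun t : ℝ ↦ ‖weilMellin g (1 / 2 + t * I)‖ ^ 2) zetaZeroHeightMeasure ∧
        weilQuadratic g = ((∫ t, ‖weilMellin g (1 / 2 + t * I)‖ ^ 2 ∂zetaZeroHeightMeasure : ℝ) : ℂ) :=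
    fun _ hg _ ↦ weilQuadratic_eq_integral_of_riemannHypothesis hRH hg
  exact im_not_mem_of_zetaZeroHeightMeasure_lt_one (measure_Icc_lt_top ha hν _ _).ne
    (measureReal_block_lt_one_of_gramCoeff_lt ha hν n hx₀ hx₀π hG) hρ

end Summit.Ventures.WeilGRH

end
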